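import Literature.Probability.LatticeModels.ONModelDobrushinStates
import Literature.Probability.LatticeModels.DobrushinShlosmanWindowDusting
import HarnessLib

/-!
# Boundary influence is antitone in the volume (consistency of a specification)
# (stub `stub_influence_antitone` of crux stmt-QuantumFields-16405, route `ConvexGribovBody`, line `Sketch` v5)

For a specification `γ`, `Λ ⊆ Λ'` and a bounded measurable `f`: if the `γ_Λ`-means of `f` vary by at most `Δ` over all
exterior data, so do its `γ_{Λ'}`-means — `γ_{Λ'} f (η) = ∫ (γ_Λ f)(σ) γ_{Λ'}(dσ|η)`
(`IsSpecification.integral_integral_consistent`), an average of values lying within `Δ` of each other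
(`FiniteSizeCriterion.abs_sub_integral_le_of_forall`-type step). Georgii 2011, Def. 1.23 (iii).
-/

set_option autoImplicit false

noncomputable section

open MeasureTheory
open Literature.Probability.LatticeModels

namespace Summit.QuantumFields.YangMills.Theorems.NonSimplyConnectedLatticeGap

/-- **Boundary influence is antitone in the volume** (registered stub `stub_influence_antitone` of the skeleton
`Cruxes/NonSimplyConnectedLatticeGap/Lines/Sketch.lean` v5 of item stmt-QuantumFields-16405; consistency of a
specification, Georgii 2011 Def. 1.23 (iii)). -/
theorem stub_influence_antitone : ∀ (V S : Type) [MeasurableSpace S] (γ : Literature.Probability.LatticeModels.Specification V S), Literature.Probability.LatticeModels.IsSpecification γ → ∀ (Λ Λ' : Finset V), Λ ⊆ Λ' → ∀ (f : (V → S) → ℝ), Measurable f → ∀ (B : ℝ), (∀ σ, |f σ| ≤ B) → ∀ (Δ : ℝ), (∀ ξ ξ' : V → S, |(∫ σ, f σ ∂(γ Λ ξ)) - ∫ σ, f σ ∂(γ Λ ξ')| ≤ Δ) → ∀ η η' : V → S, |(∫ σ, f σ ∂(γ Λ' η)) - ∫ σ, f σ ∂(γ Λ' η')| ≤ Δ :=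 by
  intro V S _ γ hγ Λ Λ' hsub f hf B hB Δ hΔ η η'
  -- the kernel mean of `f` in the smaller volume `Λ`, as a function of the exterior datum
  set g : (V → S) → ℝ := fun σ => ∫ τ, f τ ∂(γ Λ σ)
  have hgm : Measurable g := DobrushinShlosman.measurable_windowAvg' hγ Λ hf
  have hgb : ∀ σ, |g σ| ≤ B := DobrushinShlosman.abs_windowAvg_le' hγ Λ hB
  haveI := hγ.isProbability Λ' η
  haveI := hγ.isProbability Λ' η'
  have hfi : ∀ ξ : V → S, Integrable f (γ Λ' ξ) := fun ξ => by
    haveI := hγ.isProbability Λ' ξ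
    exact DobrushinMetric.integrable_of_abs_le' hf hB
  -- consistency `γ_{Λ'} γ_Λ = γ_{Λ'}`: both `Λ'`-means of `f` are `Λ'`-means of `g`
  rw [← hγ.integral_integral_consistent hsub η (hfi η),
    ← hγ.integral_integral_consistent hsub η' (hfi η')]
  change |(∫ σ, g σ ∂(γ Λ' η)) - ∫ σ, g σ ∂(γ Λ' η')| ≤ Δ
  have hgi : Integrable g (γ Λ' η) := DobrushinMetric.integrable_of_abs_le' hgm hgb
  have hgi' : Integrable g (γ Λ' η') := DobrushinMetric.integrable_of_abs_le' hgm hgb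
  -- every value of `g` is within `Δ` of the `γ_{Λ'}(· | η')`-mean of `g`
  have key : ∀ x, |g x - ∫ y, g y ∂(γ Λ' η')| ≤ Δ := by
    intro x
    have e : g x - ∫ y, g y ∂(γ Λ' η') = ∫ y, (g x - g y) ∂(γ Λ' η') := by
      rw [integral_sub (integrable_const _) hgi', integral_const]
      simp
    rw [e]
    have h := norm_integral_le_of_norm_le_const (μ := γ Λ' η') (f := fun y => g x - g y) (C := Δ)
      (ae_of_all _ fun y => by rw [Real.norm_eq_abs]; exact hΔ x y)
    simpa using h
  -- hence so is the `γ_{Λ'}(· | η)`-mean of `g`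
  have e : (∫ σ, g σ ∂(γ Λ' η)) - ∫ σ, g σ ∂(γ Λ' η') =
      ∫ σ, (g σ - ∫ y, g y ∂(γ Λ' η')) ∂(γ Λ' η) := by
    rw [integral_sub hgi (integrable_const _), integral_const]
    simp
  rw [e]
  have h := norm_integral_le_of_norm_le_const (μ := γ Λ' η)
    (f := fun σ => g σ - ∫ y, g y ∂(γ Λ' η')) (C := Δ)
    (ae_of_all _ fun σ => by rw [Real.norm_eq_abs]; exact key σ)
  simpa using h

end Summit.QuantumFields.YangMills.Theorems.NonSimplyConnectedLatticeGap

end
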